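import Literature.Analysis.FluidPDE.OnsagerBDSVEnergyPrincipalTools
import HarnessLib

/-!
# The BDSV energy estimate: discharge of the oscillatory term (G₃′) and of the principal term (G₃)

Buckmaster–De Lellis–Székelyhidi–Vicol (BDSV), *Onsager's conjecture for admissible weak
solutions*, CPAM 72 (2019) = arXiv:1701.08678, proof of Prop. 6.2, last paragraph:

> "Set `e_{q,i} := ρ_{q,i} ∇Φ_i⁻¹ tr C_k(R̃_i) ∇Φ_i⁻ᵀ` and use Proposition 5.7 and Lemma 5.4 to
> conclude `‖e_{q,i}‖_N ≲ δ_{q+1} ℓ^{-N}`. Next observe that at any given time at most two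
> `e_{q,i}` are nonvanishing. Hence use (C.1) in Proposition C.2 to bound
> `|∫ ∑_i ∑_{k≠0} ρ_i ∇Φ_i⁻¹ tr C_k(R̃_i) ∇Φ_i⁻ᵀ e^{iλ_{q+1}k·Φ_i} dx| ≲ ∑_{k≠0} δ_{q+1}ℓ^{-N}/(λ_{q+1}^N|k|^N)`.
> As already argued several time, we can choose `N` such that
> `δ_{q+1}ℓ^{-N}/λ_{q+1}^N ≤ δ_{q+1}δ_q^{1/2}λ_q/λ_{q+1}`."

This file PROVES the named fact G₃′ `BDSV.energy_oscillatoryTerm` of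
`OnsagerBDSVEnergyPrincipal.lean` (`BDSV.energy_oscillatoryTerm_holds`), and hence G₃
`BDSV.energy_principalTerm` (`BDSV.energy_principalTerm_holds`, through the proved reduction
`BDSV.energy_principalTerm_of_oscillatoryTerm`). The printed argument is followed with two
substitutions of equal strength (the tools — all-orders (5.23), entrywise (5.24), the mean-free
profile, the phase frame at active times — being `OnsagerBDSVEnergyPrincipalTools.lean`): the Fourier expansion `∑_{k≠0} C_k(R) e^{ik·ξ}` of the mean-free
tensor is replaced by its exact telescoping decomposition into `ξ`-derivatives of smooth zero-mean
profiles (`OnsagerBDSVTorusPrimitives.lean`), and (C.1) by the `K`-fold integration by parts of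
`OnsagerBDSVNonstationaryPhase.lean` (`BDSV.PhaseFrame.levelBound`); the decay in `|k|` and the
summability `N > 4` are thereby traded for compactness (uniform bounds of finitely many smooth
descendants of the profile on `B̄(Id, 1/10) × T³`). The inputs:

* Prop. 5.7, arXiv (5.23), at all orders `k ≤ K` along one prefix (`BDSV.gradPhiBound_allOrders`,
  from the proved `BDSV.gradPhiBound_holds`), giving scaled bounds on `∇Φ_i` and
  `adj ∇Φ_i = ∇Φ_i⁻¹` (`det ∇Φ_i = 1`, `OnsagerBDSVFlowJacobian.lean`);
* arXiv (5.24) `‖R̃_{q,i}‖_N ≲ ℓ^{-N}` in entrywise scaled form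
  (`BDSV.PerturbationData.scaledBound_tildeR`: Leibniz on `R̃ = ∇Φ(Id - c R̊̄)∇Φᵀ` with (2.20),
  `c = ∑∫η²/ρ_q ≤ 8λ_q^α/δ_{q+1}` and `λ_q^αℓ^α ≤ 1`);
* Lemma 5.4: `R̃_{q,i} ∈ B̄(Id, 1/10)` on active times (`BDSV.PerturbationData.tildeR_mem_closedBall`),
  where the Mikado identity `⨍ W ⊗ W = R` makes the fluctuation mean-free
  (`BDSV.MikadoDatum.fluctZ_eq_of_mem`), and the bounds on `ρ_q`, `∑∫η²` giving
  `‖ρ_{q,i}‖_{C^k} ≲ δ_{q+1}` through Lemma 5.3 (`C_η(0,k)`);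
* "at most two `e_{q,i}` are nonvanishing" (`BDSV.CutoffFamily.sum_abs_le_two_mul`, from (iv));
* the choice of `N`: `K = ⌈2(b-1+β)/((b-1)(1-β))⌉ + 1` integrations by parts and
  `α < (b-1)(1-β)/3` give `(ℓλ_{q+1})^{-K} ≤ δ_q^{1/2}λ_qλ_{q+1}^{-1}` for `a` large
  (`BDSV.exists_threshold_phase`, an instance of the master lemma `BDSV.exists_freq_triple_le`),
  with `n_{q+1} = λ_{q+1}/(2π)`.

The threshold in `α` is `min(α₀(5.23), βb(b-1), (b-1)(1-β)/3)`, `N̄ = max(N̄(5.23, K), K)`, and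
the constant is `54 (phaseConst K Λ²)^K (2π)^K F₁ U` with `Λ = BDSV.frameConst K C_J C_in⁺`,
`F₁ = (3^K(K+1))³ Λ² (∑_{k≤K}|C_η(0,k)|)²/c₀` and `U = U(𝔚, K)`.

## References

* T. Buckmaster, C. De Lellis, L. Székelyhidi Jr., V. Vicol, *Onsager's conjecture for admissible
  weak solutions*, Comm. Pure Appl. Math. 72 (2019) 229–274 = arXiv:1701.08678: proof of
  Prop. 6.2 (last paragraph); §5.1 Lemma 5.1, (5.6); §5.2 (i)–(v), Lemma 5.3, Lemma 5.4;
  §5.5 Prop. 5.7 (arXiv (5.23)–(5.24)); §2.5 (2.20); App. C Prop. C.2 (C.1).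
-/

open MeasureTheory Set Filter
open scoped NNReal ENNReal ContDiff Matrix Matrix.Norms.Elementwise

noncomputable section

namespace Literature.Analysis.FluidPDE

namespace BDSV

open FunctionSpaces FunctionSpaces.Torus

/-- The flat three-torus `T³ = (ℝ/ℤ)³`, local notation. -/
local notation "𝕋³" => UnitAddTorus (Fin 3)

/-- Euclidean `ℝ³`, local notation. -/
local notation "ℝ³" => EuclideanSpace ℝ (Fin 3)

/-- Real `3 × 3` matrices, local notation. -/
local notation "𝕄" => Matrix (Fin 3) (Fin 3) ℝ

/-! ## The `i`-th summand of the oscillatory term -/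

section TermI

variable {P : Params} {S : Setting} {Nbar : ℕ} {Cin C₀ c₀ : ℝ} {Cη : ℕ → ℕ → ℝ}

variable (P S) in
/-- The `i`-th summand of the oscillatory term of the energy,
`∫ ρ_{q,i} tr(adj ∇Φ_i · (W ⊗ W - R)(R̃_{q,i}, n_{q+1}Φ_i) · (adj ∇Φ_i)ᵀ) dx`.
[cite: BuckmasterEtAl2018, Prop. 6.2 (proof, last paragraph)] -/
def oscTermI (𝔚 : MikadoDatum mikadoRadius) (η : ℕ → ℝ → 𝕋³ → ℝ) (D : ℕ → ℝ → 𝕋³ → ℝ³)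
    (i : ℕ) (t : ℝ) : ℝ :=
  ∫ x, rhoI P S η i t x * Matrix.trace ((gradPhi D i t x).adjugate *
    𝔚.fluct (tildeR P S η D i t x) (P.freqNat (S.q + 1) • phiPoint D i t x) *
      ((gradPhi D i t x).adjugate)ᵀ)

/-- **The summand of the oscillatory integrand in composite form**:
`ρ_i tr(A G(R̃, nΦ) Aᵀ) = ∑_{c,a,b} (ρ_i A_{ca} A_{cb}) · G_{ab}(R̃(x), nΦ(x))`. [folklore] -/
theorem oscSummand_eq (𝔚 : MikadoDatum mikadoRadius) (η : ℕ → ℝ → 𝕋³ → ℝ)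
    (D : ℕ → ℝ → 𝕋³ → ℝ³) (i : ℕ) (t : ℝ) (x : 𝕋³) :
    rhoI P S η i t x * Matrix.trace ((gradPhi D i t x).adjugate *
      𝔚.fluct (tildeR P S η D i t x) (P.freqNat (S.q + 1) • phiPoint D i t x) *
        ((gradPhi D i t x).adjugate)ᵀ) =
      ∑ c, ∑ a, ∑ b, (rhoI P S η i t x * (jac (D i t) x).adjugate c a *
        (jac (D i t) x).adjugate c b) *
          phaseComp (𝔚.fluctFam a b) (fun y => tildeR P S η D i t y) (D i t) (P.freqNat (S.q + 1)) x := by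
  have e1 : ∀ a b, 𝔚.fluct (tildeR P S η D i t x) (P.freqNat (S.q + 1) • phiPoint D i t x) a b =
      phaseComp (𝔚.fluctFam a b) (fun y => tildeR P S η D i t y) (D i t) (P.freqNat (S.q + 1)) x :=
    fun a b => rfl
  have e2 : gradPhi D i t x = jac (D i t) x := rfl
  rw [trace_mul_mul_transpose, e2, Finset.mul_sum]
  refine Finset.sum_congr rfl fun c _ => ?_
  rw [Finset.mul_sum]
  refine Finset.sum_congr rfl fun a _ => ?_
  rw [Finset.mul_sum]
  refine Finset.sum_congr rfl fun b _ => ?_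
  rw [e1]
  ring

/-- The summand vanishes identically at times where `η_i` does. [folklore] -/
theorem oscTermI_eq_zero_of_eta (𝔚 : MikadoDatum mikadoRadius) (𝒟 : PerturbationData P S c₀ Cη)
    {i : ℕ} {t : ℝ} (hη : ∀ x, 𝒟.cut.η i t x = 0) : oscTermI P S 𝔚 𝒟.cut.η 𝒟.D i t = 0 := by
  unfold oscTermI
  have h : ∀ x, rhoI P S 𝒟.cut.η i t x = 0 := fun x => by
    rw [rhoI, hη x]
    ring
  simp only [h, zero_mul, integral_zero]

/-- **The bound on the `i`-th summand at an active time** (the heart of the last paragraph of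
the proof of Prop. 6.2): in the phase frame of the construction, with `U` a uniform bound for the
level-`K` descendants of the mean-free Mikado tensor on `B̄(Id,1/10) × T³`,
`|∫ ρ_i tr(A G Aᵀ)| ≤ 27 X^K F U`, `X = phaseConst K · Λ² · (n_{q+1}ℓ)⁻¹`,
`F = (3^K(K+1))³ Λ² (∑_{k≤K}|C_η(0,k)|)² δ_{q+1}/c₀`.
[cite: BuckmasterEtAl2018, Prop. 6.2 (proof, last paragraph)] -/
theorem PerturbationData.abs_oscTermI_le (H : PerturbationHypotheses P S Nbar Cin C₀)
    (𝒟 : PerturbationData P S c₀ Cη) (𝔚 : MikadoDatum mikadoRadius) (hc₀ : 0 < c₀) (hCin : 0 ≤ Cin)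
    (ha : 1 ≤ P.a) (hb : 1 ≤ P.b) (hβ : 0 ≤ P.β) (hα : 0 ≤ P.α)
    (h4 : 4 * amp P.β P.a P.b (S.q + 2) ≤ amp P.β P.a P.b (S.q + 1) * freq P.a P.b S.q ^ (-P.α))
    (hdef : Real.exp (4 * (Cin * mollScale P.β P.α P.a P.b S.q ^ (2 * P.α))) - 1 ≤ 1 / 300)
    (hstr : 8 * (Cin * (freq P.a P.b S.q ^ P.α * mollScale P.β P.α P.a P.b S.q ^ P.α)) ≤ 1 / 100)
    {K : ℕ} (hK : K ≤ Nbar) {CJ : ℝ} (hCJ : 0 ≤ CJ) {i : ℕ} {t : ℝ} (ht : t ∈ Icc 0 S.T)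
    (hJ : ∀ k ≤ K, Torus.eContDiffHolderNorm k 0 (fun x => gradPhi 𝒟.D i t x) ≤
      ENNReal.ofReal (CJ * mollScale P.β P.α P.a P.b S.q ^ (-(k : ℝ))))
    (hJinv : ∀ k ≤ K, Torus.eContDiffHolderNorm k 0 (fun x => (gradPhi 𝒟.D i t x)⁻¹) ≤
      ENNReal.ofReal (CJ * mollScale P.β P.α P.a P.b S.q ^ (-(k : ℝ))))
    {x' : 𝕋³} (hη : 𝒟.cut.η i t x' ≠ 0) {U : ℝ} (hU0 : 0 ≤ U)
    (hU : ∀ a b, ∀ v ∈ descSet K (𝔚.fluctZ a b), ∀ R ∈ Metric.closedBall (1 : 𝕄) mikadoRadius,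
      ∀ ξ, |v R ξ| ≤ U) :
    |oscTermI P S 𝔚 𝒟.cut.η 𝒟.D i t| ≤
      27 * ((phaseConst K * frameConst K CJ Cin ^ 2 *
        ((P.freqNat (S.q + 1) : ℝ) * mollScale P.β P.α P.a P.b S.q)⁻¹) ^ K *
        ((3 : ℝ) ^ K * (K + 1) * (3 ^ K * (K + 1) * (amp P.β P.a P.b (S.q + 1) / c₀ *
          (3 ^ K * (K + 1) * (∑ k ∈ Finset.range (K + 1), |Cη 0 k|) ^ 2)) *
            frameConst K CJ Cin) * frameConst K CJ Cin) * U) := by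
  -- notation
  set ℓ := mollScale P.β P.α P.a P.b S.q with hℓdef
  set n : ℕ := P.freqNat (S.q + 1) with hndef
  set Λ := frameConst K CJ Cin with hΛdef
  set Cη' : ℝ := ∑ k ∈ Finset.range (K + 1), |Cη 0 k| with hCη'
  set c₁ : ℝ := (3 : ℝ) ^ K * (K + 1) with hc₁def
  set δ := amp P.β P.a P.b (S.q + 1) with hδdef
  set Rt : 𝕋³ → 𝕄 := fun x => tildeR P S 𝒟.cut.η 𝒟.D i t x with hRtdef
  have hℓ : 0 < ℓ := mollScale_pos ha _
  have hli : 1 ≤ ℓ⁻¹ := one_le_mollScale_inv ha hb hβ hα _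
  have hδ : 0 < δ := amp_pos ha _
  have hc₁ : 0 ≤ c₁ := by positivity
  have hCη'0 : 0 ≤ Cη' := Finset.sum_nonneg fun k _ => abs_nonneg _
  -- the frame
  have hP : PhaseFrame Rt (𝒟.D i t) n K ℓ Λ (Metric.closedBall (1 : 𝕄) mikadoRadius) :=
    𝒟.phaseFrame H hCin ha hb hβ hα h4 hdef hstr hK hCJ ht hJ hJinv hη
  have hΛ0 : 0 ≤ Λ := zero_le_one.trans hP.one_le_Λ
  have hρpos : ∀ s ∈ Icc 0 S.T, 0 < rhoQ P S s := fun s hs =>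
    lt_of_lt_of_le (div_pos (mul_pos (amp_pos ha _) (Real.rpow_pos_of_pos (freq_pos ha _) _))
      (by norm_num)) (H.le_rhoQ h4 hs)
  have hSD : SmoothData P S 𝒟.cut.η 𝒟.D := H.toSmoothData hc₀ 𝒟 hρpos
  -- the amplitude `ρ_i A_{ca} A_{cb}` and its scaled bound
  set sc : ℝ := rhoQ P S t / etaMass P S 𝒟.cut.η t with hscdef
  have hsc0 : 0 ≤ sc := div_nonneg (hρpos t ht).le (hc₀.le.trans (𝒟.le_etaMass ht))
  have hsc : sc ≤ δ / c₀ := div_le_div₀ hδ.le (H.rhoQ_le ha ht) hc₀ (𝒟.le_etaMass ht)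
  have hηs : IsSmooth (𝒟.cut.η i t) := (𝒟.cut.smooth i).isSmooth_slice ht
  have hηB : ScaledBound (𝒟.cut.η i t) K ℓ Cη' := by
    intro k hk
    have h := 𝒟.cut.deriv_le i 0 k t ht
    simp only [Function.iterate_zero, id_eq, Nat.cast_zero, neg_zero, Real.rpow_zero, mul_one] at h
    refine h.trans (ENNReal.ofReal_le_ofReal ?_)
    have h1 : Cη 0 k ≤ Cη' := (le_abs_self _).trans
      (Finset.single_le_sum (f := fun k => |Cη 0 k|) (fun _ _ => abs_nonneg _)
        (Finset.mem_range.2 (Nat.lt_succ_of_le hk)))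
    exact h1.trans (le_mul_of_one_le_right hCη'0 (one_le_pow₀ hli))
  have hρs : IsSmooth (rhoI P S 𝒟.cut.η i t) := (hSD.rhoI i).isSmooth_slice ht
  have hρB : ScaledBound (rhoI P S 𝒟.cut.η i t) K ℓ (δ / c₀ * (c₁ * Cη' ^ 2)) := by
    have e : rhoI P S 𝒟.cut.η i t = fun x => sc * (𝒟.cut.η i t x * 𝒟.cut.η i t x) := by
      funext x
      rw [rhoI, hscdef]
      ring
    have h := ((hηB.mul hηB hηs hηs hCη'0 hCη'0 hℓ).const_mul (hηs.mul hηs) sc)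
    rw [e]
    refine h.mono_M ?_ hℓ
    rw [abs_of_nonneg hsc0, hc₁def]
    have : 0 ≤ (3 : ℝ) ^ K * (K + 1) * Cη' * Cη' := by positivity
    nlinarith
  have hA : ∀ m j, IsSmooth fun x => (jac (𝒟.D i t) x).adjugate m j := fun m j =>
    isSmooth_adjugate_jac_entry hP.smooth_D m j
  set F : ℝ := c₁ * (c₁ * (δ / c₀ * (c₁ * Cη' ^ 2)) * Λ) * Λ with hFdef
  have hF : 0 ≤ F := by positivity
  have hfs : ∀ c a b, IsSmooth fun x => rhoI P S 𝒟.cut.η i t x * (jac (𝒟.D i t) x).adjugate c a *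
      (jac (𝒟.D i t) x).adjugate c b := fun c a b => (hρs.mul (hA c a)).mul (hA c b)
  have hfB : ∀ c a b, ScaledBound (fun x => rhoI P S 𝒟.cut.η i t x * (jac (𝒟.D i t) x).adjugate c a *
      (jac (𝒟.D i t) x).adjugate c b) K ℓ F := by
    intro c a b
    have h1 := hρB.mul (hP.adj_bound c a) hρs (hA c a) (by positivity) hΛ0 hℓ
    have h2 := h1.mul (hP.adj_bound c b) (hρs.mul (hA c a)) (hA c b) (by positivity) hΛ0 hℓ
    refine h2.mono_M (le_of_eq ?_) hℓ
    rw [hFdef, hc₁def]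
  -- the profiles: `G = G̃` along the frame
  have hGeq : ∀ a b x, phaseComp (𝔚.fluctFam a b) Rt (𝒟.D i t) n x =
      phaseComp (𝔚.fluctZ a b) Rt (𝒟.D i t) n x := by
    intro a b x
    unfold phaseComp
    exact (𝔚.fluctZ_eq_of_mem a b (hP.mem x)
      (isSymm_tildeR (fun p q => H.eulerReynolds.symm t ht x p q) i) _).symm
  -- each of the 27 integrals
  have hI : ∀ c a b, |∫ x, (rhoI P S 𝒟.cut.η i t x * (jac (𝒟.D i t) x).adjugate c a *
      (jac (𝒟.D i t) x).adjugate c b) * phaseComp (𝔚.fluctFam a b) Rt (𝒟.D i t) n x| ≤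
      (phaseConst K * Λ ^ 2 * ((n : ℝ) * ℓ)⁻¹) ^ K * F * U := by
    intro c a b
    simp only [hGeq a b]
    exact hP.levelBound K le_rfl (𝔚.fluctZ a b) _ F U (𝔚.jointSmooth_fluctZ a b) (𝔚.integral_fluctZ a b)
      (hfs c a b) hF (hfB c a b) hU0 (hU a b)
  -- integrability and splitting of the integral
  have hint : ∀ c a b, Integrable fun x => (rhoI P S 𝒟.cut.η i t x * (jac (𝒟.D i t) x).adjugate c a *
      (jac (𝒟.D i t) x).adjugate c b) * phaseComp (𝔚.fluctFam a b) Rt (𝒟.D i t) n x := fun c a b =>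
    ((hfs c a b).mul ((𝔚.jointSmooth_fluctFam a b).phaseComp hP.smooth_Rt hP.smooth_D n)).integrable
  have hsplit : oscTermI P S 𝔚 𝒟.cut.η 𝒟.D i t = ∑ c, ∑ a, ∑ b, ∫ x,
      (rhoI P S 𝒟.cut.η i t x * (jac (𝒟.D i t) x).adjugate c a * (jac (𝒟.D i t) x).adjugate c b) *
        phaseComp (𝔚.fluctFam a b) Rt (𝒟.D i t) n x := by
    unfold oscTermI
    simp only [oscSummand_eq]
    rw [integral_finsetSum _ fun c _ =>
      integrable_finsetSum _ fun a _ => integrable_finsetSum _ fun b _ => hint c a b]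
    refine Finset.sum_congr rfl fun c _ => ?_
    rw [integral_finsetSum _ fun a _ => integrable_finsetSum _ fun b _ => hint c a b]
    refine Finset.sum_congr rfl fun a _ => ?_
    rw [integral_finsetSum _ fun b _ => hint c a b]
  rw [hsplit]
  refine (Finset.abs_sum_le_sum_abs _ _).trans ?_
  have h27 : ∀ c, |∑ a, ∑ b, ∫ x, (rhoI P S 𝒟.cut.η i t x * (jac (𝒟.D i t) x).adjugate c a *
      (jac (𝒟.D i t) x).adjugate c b) * phaseComp (𝔚.fluctFam a b) Rt (𝒟.D i t) n x| ≤
      9 * ((phaseConst K * Λ ^ 2 * ((n : ℝ) * ℓ)⁻¹) ^ K * F * U) := by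
    intro c
    refine (Finset.abs_sum_le_sum_abs _ _).trans ?_
    have h9 : ∀ a, |∑ b, ∫ x, (rhoI P S 𝒟.cut.η i t x * (jac (𝒟.D i t) x).adjugate c a *
        (jac (𝒟.D i t) x).adjugate c b) * phaseComp (𝔚.fluctFam a b) Rt (𝒟.D i t) n x| ≤
        3 * ((phaseConst K * Λ ^ 2 * ((n : ℝ) * ℓ)⁻¹) ^ K * F * U) := by
      intro a
      refine (Finset.abs_sum_le_sum_abs _ _).trans ?_
      refine (Finset.sum_le_sum fun b _ => hI c a b).trans ?_
      simp
    refine (Finset.sum_le_sum fun a _ => h9 a).trans ?_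
    simp only [Finset.sum_const, Finset.card_univ, Fintype.card_fin, nsmul_eq_mul, Nat.cast_ofNat]
    linarith
  refine (Finset.sum_le_sum fun c _ => h27 c).trans ?_
  simp only [Finset.sum_const, Finset.card_univ, Fintype.card_fin, nsmul_eq_mul, Nat.cast_ofNat]
  rw [hFdef, hc₁def, hδdef, hΛdef, hndef, hℓdef]
  linarith

end TermI

/-! ## At most two cut-offs are active at any time -/

section Counting

variable {T τ c₀ : ℝ} {Cη : ℕ → ℕ → ℝ}

/-- **At any time at most two cut-offs are active** (property (iv): `supp η_i` lies over
`(t_i - τ/3, t_{i+1} + τ/3)`, and these windows are met by `t` for at most two consecutive `i`),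
in the quantitative form used: if `g i = 0` whenever `η_i(t,·) ≡ 0` and `|g i| ≤ B` always, then
`∑_{i<M} |g i| ≤ 2B`. [cite: BuckmasterEtAl2018, Prop. 6.2 (proof: "at most two e_{q,i} are nonvanishing")] -/
theorem CutoffFamily.sum_abs_le_two_mul (cut : CutoffFamily T τ c₀ Cη) (hτ : 0 < τ) {t : ℝ}
    {g : ℕ → ℝ} {B : ℝ} (hB : 0 ≤ B) (hzero : ∀ i, (∀ x, cut.η i t x = 0) → g i = 0)
    (hbound : ∀ i, |g i| ≤ B) (M : ℕ) :
    ∑ i ∈ Finset.range M, |g i| ≤ 2 * B := by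
  classical
  set A := (Finset.range M).filter (fun i => ∃ x, cut.η i t x ≠ 0) with hA
  -- outside `A` the summands vanish
  have hsum : ∑ i ∈ Finset.range M, |g i| = ∑ i ∈ A, |g i| := by
    rw [hA, Finset.sum_filter]
    refine Finset.sum_congr rfl fun i _ => ?_
    split_ifs with h
    · rfl
    · simp only [not_exists, not_not] at h
      rw [hzero i h, abs_zero]
  -- `A` has at most two elements
  set y : ℝ := t / τ - 4 / 3 with hy
  set n₁ : ℤ := ⌊y⌋ + 1 with hn₁
  have hwin : ∀ i ∈ A, (i : ℤ) = n₁ ∨ (i : ℤ) = n₁ + 1 := by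
    intro i hi
    obtain ⟨x, hx⟩ := (Finset.mem_filter.1 hi).2
    obtain ⟨h1, h2⟩ := cut.support i t x hx
    have hi1 : y < i := by
      rw [hy]
      have : t / τ < (i : ℝ) + 1 + 1 / 3 := by
        rw [div_lt_iff₀ hτ]
        nlinarith
      linarith
    have hi2 : (i : ℝ) < y + 5 / 3 := by
      rw [hy]
      have : (i : ℝ) - 1 / 3 < t / τ := by
        rw [lt_div_iff₀ hτ]
        nlinarith
      linarith
    have hfl1 : (⌊y⌋ : ℝ) ≤ y := Int.floor_le y
    have hfl2 : y < (⌊y⌋ : ℝ) + 1 := Int.lt_floor_add_one y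
    have hlo : ⌊y⌋ + 1 ≤ (i : ℤ) := by
      have : (⌊y⌋ : ℝ) < ((i : ℤ) : ℝ) := by
        rw [Int.cast_natCast]
        linarith
      exact Int.add_one_le_iff.2 (by exact_mod_cast this)
    have hhi : (i : ℤ) ≤ ⌊y⌋ + 2 := by
      have : ((i : ℤ) : ℝ) < (⌊y⌋ : ℝ) + 3 := by
        rw [Int.cast_natCast]
        linarith
      have h3 : (i : ℤ) < ⌊y⌋ + 3 := by exact_mod_cast this
      omega
    rw [hn₁]
    omega
  have hcard : A.card ≤ 2 := by
    have hsub : ∀ i ∈ A, ((i : ℤ)) ∈ ({n₁, n₁ + 1} : Finset ℤ) := by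
      intro i hi
      rcases hwin i hi with h | h <;> simp [h]
    have hinj : Set.InjOn (fun i : ℕ => (i : ℤ)) A := fun i _ j _ h => by
      have h' : (i : ℤ) = (j : ℤ) := h
      exact_mod_cast h'
    exact (Finset.card_le_card_of_injOn _ hsub hinj).trans Finset.card_le_two
  rw [hsum]
  calc ∑ i ∈ A, |g i| ≤ ∑ i ∈ A, B := Finset.sum_le_sum fun i _ => hbound i
    _ = A.card * B := by rw [Finset.sum_const, nsmul_eq_mul]
    _ ≤ 2 * B := by
        have : (A.card : ℝ) ≤ 2 := by exact_mod_cast hcard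
        nlinarith

end Counting

/-! ## The parameter inequality: the choice of `N` -/

section Parameter

variable {β b α : ℝ}

/-- **The choice of `N` in the proof of Prop. 6.2** ("we can choose `N` such that
`δ_{q+1}ℓ^{-N}/λ_{q+1}^N ≤ δ_{q+1}δ_q^{1/2}λ_q/λ_{q+1}`"): if `K[(b-1)(1-β) - 3α/2] > b - 1 + β`
then `(ℓλ_{q+1})^{-K} ≤ δ_q^{1/2} λ_q λ_{q+1}^{-1}` for all `q`, once `a` is large — the
`a`-exponent of `(ℓλ_{q+1})^{-K} δ_q^{-1/2} λ_q^{-1} λ_{q+1}` is `-K[(b-1)(1-β) - 3α/2] + (b-1+β) < 0`.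
[cite: BuckmasterEtAl2018, Prop. 6.2 (proof, choice of N)] -/
theorem exists_threshold_phase (hb : 1 ≤ b) {K : ℕ}
    (hK : b - 1 + β < K * ((b - 1) * (1 - β) - 3 * α / 2)) :
    ∃ a₁ : ℝ, 1 < a₁ ∧ ∀ a : ℝ, a₁ ≤ a → ∀ q : ℕ,
      ((mollScale β α a b q * freq a b (q + 1))⁻¹) ^ K ≤
        Real.sqrt (amp β a b q) * freq a b q * (freq a b (q + 1))⁻¹ := by
  have hE : (K * (1 - β + 3 * α / 2) - (1 - β)) + b * (K * (β - 1) + 1) + b ^ 2 * 0 < 0 := by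
    nlinarith
  obtain ⟨a₁, ha₁, h⟩ := exists_freq_triple_le hb hE 1
  refine ⟨a₁, ha₁, fun a ha q => ?_⟩
  have ha1 : (1 : ℝ) ≤ a := ha₁.le.trans ha
  have hf0 := freq_pos (b := b) ha1 q
  have hf1 := freq_pos (b := b) ha1 (q + 1)
  have hℓ := mollScale_pos (β := β) (α := α) (b := b) ha1 q
  have key := h a ha q
  rw [Real.rpow_zero, mul_one, one_mul] at key
  -- `(ℓ λ_{q+1})⁻¹ = λ_q^{1-β+3α/2} λ_{q+1}^{β-1}`
  have hmon : (mollScale β α a b q * freq a b (q + 1))⁻¹ =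
      freq a b q ^ (1 - β + 3 * α / 2) * freq a b (q + 1) ^ (β - 1) := by
    rw [mul_inv, mollScale_inv_eq ha1, show β - 1 = β + (-1) by ring, Real.rpow_add hf1,
      Real.rpow_neg_one]
    ring
  have hpowK : ((mollScale β α a b q * freq a b (q + 1))⁻¹) ^ K =
      freq a b q ^ (K * (1 - β + 3 * α / 2)) * freq a b (q + 1) ^ (K * (β - 1)) := by
    rw [hmon, mul_pow, ← Real.rpow_natCast, ← Real.rpow_natCast, ← Real.rpow_mul hf0.le,
      ← Real.rpow_mul hf1.le, mul_comm (1 - β + 3 * α / 2), mul_comm (β - 1)]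
  -- split the monomial of `key`
  have hsplit : freq a b q ^ (K * (1 - β + 3 * α / 2) - (1 - β)) * freq a b (q + 1) ^ (K * (β - 1) + 1) =
      (freq a b q ^ (K * (1 - β + 3 * α / 2)) * freq a b (q + 1) ^ (K * (β - 1))) *
        (freq a b q ^ (-(1 - β)) * freq a b (q + 1)) := by
    rw [sub_eq_add_neg, Real.rpow_add hf0, Real.rpow_add hf1, Real.rpow_one]
    ring
  rw [hsplit, ← hpowK] at key
  have hsq : Real.sqrt (amp β a b q) * freq a b q * (freq a b (q + 1))⁻¹ =
      (freq a b q ^ (-(1 - β)) * freq a b (q + 1))⁻¹ := by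
    rw [sqrt_amp ha1, mul_inv, ← Real.rpow_neg hf0.le, neg_neg, show (1 - β) = (-β) + 1 by ring,
      Real.rpow_add hf0, Real.rpow_one]
  rw [hsq]
  have hpos : 0 < freq a b q ^ (-(1 - β)) * freq a b (q + 1) := mul_pos (Real.rpow_pos_of_pos hf0 _) hf1
  have : ((mollScale β α a b q * freq a b (q + 1))⁻¹) ^ K ≤ 1 / (freq a b q ^ (-(1 - β)) * freq a b (q + 1)) := by
    rw [le_div_iff₀ hpos]
    exact key
  rwa [one_div] at this

end Parameter

/-! ## Assembly: the discharge of G₃′ (and hence of G₃) -/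

section Discharge

variable {P : Params} {S : Setting} {Nbar : ℕ} {Cin C₀ c₀ : ℝ} {Cη : ℕ → ℕ → ℝ}

/-- The summands of the oscillatory integrand are integrable (smooth) under the standing
hypotheses with `ρ_q > 0`. [folklore] -/
theorem PerturbationData.integrable_oscSummand (H : PerturbationHypotheses P S Nbar Cin C₀)
    (𝒟 : PerturbationData P S c₀ Cη) (𝔚 : MikadoDatum mikadoRadius) (hc₀ : 0 < c₀)
    (hρ : ∀ s ∈ Icc 0 S.T, 0 < rhoQ P S s) (i : ℕ) {t : ℝ} (ht : t ∈ Icc 0 S.T) :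
    Integrable fun x => rhoI P S 𝒟.cut.η i t x * Matrix.trace ((gradPhi 𝒟.D i t x).adjugate *
      𝔚.fluct (tildeR P S 𝒟.cut.η 𝒟.D i t x) (P.freqNat (S.q + 1) • phiPoint 𝒟.D i t x) *
        ((gradPhi 𝒟.D i t x).adjugate)ᵀ) := by
  have hSD : SmoothData P S 𝒟.cut.η 𝒟.D := H.toSmoothData hc₀ 𝒟 hρ
  have hρs : IsSmooth (rhoI P S 𝒟.cut.η i t) := (hSD.rhoI i).isSmooth_slice ht
  have hDs : IsSmooth (𝒟.D i t) := (𝒟.flow i).smooth.isSmooth_slice ht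
  have hA : ∀ m j, IsSmooth fun x => (jac (𝒟.D i t) x).adjugate m j := fun m j =>
    isSmooth_adjugate_jac_entry hDs m j
  have hRt : IsSmooth fun x => tildeR P S 𝒟.cut.η 𝒟.D i t x :=
    𝒟.isSmooth_tildeR H (fun s hs => (hρ s hs).ne') i ht
  have hterm : ∀ c a b, Integrable fun x => (rhoI P S 𝒟.cut.η i t x * (jac (𝒟.D i t) x).adjugate c a *
      (jac (𝒟.D i t) x).adjugate c b) * phaseComp (𝔚.fluctFam a b)
        (fun y => tildeR P S 𝒟.cut.η 𝒟.D i t y) (𝒟.D i t) (P.freqNat (S.q + 1)) x := fun c a b =>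
    (((hρs.mul (hA c a)).mul (hA c b)).mul
      ((𝔚.jointSmooth_fluctFam a b).phaseComp hRt hDs _)).integrable
  have e : (fun x => rhoI P S 𝒟.cut.η i t x * Matrix.trace ((gradPhi 𝒟.D i t x).adjugate *
      𝔚.fluct (tildeR P S 𝒟.cut.η 𝒟.D i t x) (P.freqNat (S.q + 1) • phiPoint 𝒟.D i t x) *
        ((gradPhi 𝒟.D i t x).adjugate)ᵀ)) = fun x => ∑ c, ∑ a, ∑ b,
      (rhoI P S 𝒟.cut.η i t x * (jac (𝒟.D i t) x).adjugate c a * (jac (𝒟.D i t) x).adjugate c b) *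
        phaseComp (𝔚.fluctFam a b) (fun y => tildeR P S 𝒟.cut.η 𝒟.D i t y) (𝒟.D i t)
          (P.freqNat (S.q + 1)) x := funext fun x => oscSummand_eq 𝔚 𝒟.cut.η 𝒟.D i t x
  rw [e]
  exact integrable_finsetSum _ fun c _ => integrable_finsetSum _ fun a _ =>
    integrable_finsetSum _ fun b _ => hterm c a b

/-- `Osc(t) = ∑_i (i-th summand)` (integral of a finite sum). [folklore] -/
theorem PerturbationData.oscTerm_eq_sum (H : PerturbationHypotheses P S Nbar Cin C₀)
    (𝒟 : PerturbationData P S c₀ Cη) (𝔚 : MikadoDatum mikadoRadius) (hc₀ : 0 < c₀)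
    (hρ : ∀ s ∈ Icc 0 S.T, 0 < rhoQ P S s) {t : ℝ} (ht : t ∈ Icc 0 S.T) :
    oscTerm P S 𝔚 𝒟.cut.η 𝒟.D t =
      ∑ i ∈ Finset.range (cutoffCount S.T (P.τ S.q)), oscTermI P S 𝔚 𝒟.cut.η 𝒟.D i t := by
  unfold oscTerm oscIntegrand oscTermI
  exact integral_finsetSum _ fun i _ => 𝒟.integrable_oscSummand H 𝔚 hc₀ hρ i ht

/-- **Discharge of G₃′ `BDSV.energy_oscillatoryTerm`** (BDSV, proof of Prop. 6.2, last
paragraph): along the common prefix, `|Osc(t)| ≤ C δ_{q+1} δ_q^{1/2} λ_q λ_{q+1}⁻¹` for every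
`t ∈ [0,T]`. The printed argument (Fourier expansion of `W ⊗ W - R`, `‖e_{q,i}‖_N ≲ δ_{q+1}ℓ^{-N}`,
"at most two `e_{q,i}` are nonvanishing", the stationary-phase estimate (C.1), the choice of `N`
with `δ_{q+1}ℓ^{-N}λ_{q+1}^{-N} ≤ δ_{q+1}δ_q^{1/2}λ_qλ_{q+1}^{-1}`) is carried out with the
Fourier expansion replaced by the exact telescoping decomposition of the mean-free tensor into
`ξ`-derivatives (`OnsagerBDSVTorusPrimitives.lean`) and (C.1) by the `K`-fold integration by
parts of `OnsagerBDSVNonstationaryPhase.lean` (`K = ⌈2(b-1+β)/((b-1)(1-β))⌉ + 1`,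
`α < (b-1)(1-β)/3`); the inputs are the proved deformation bounds `BDSV.gradPhiBound_holds`
(Prop. 5.7, all orders `≤ K`), (2.20), Lemma 5.4 (`BDSV.PerturbationData.tildeR_mem_closedBall`,
`ρ_q` bounds) and the parameter inequality `BDSV.exists_threshold_phase`.
[cite: BuckmasterEtAl2018, Prop. 6.2 (proof, last paragraph) and Prop. C.2 (C.1)] -/
theorem energy_oscillatoryTerm_holds : energy_oscillatoryTerm := by
  intro 𝔚 c₀ hc₀ Cη β hβ hβ' b hb hb'
  have hb0 : (0 : ℝ) < b := by linarith
  have hb1 : 0 < b - 1 := by linarith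
  have h1β : 0 < 1 - β := by linarith
  have hβb : 0 < β * b * (b - 1) := by positivity
  have hpos : 0 < (b - 1) * (1 - β) := mul_pos hb1 h1β
  obtain ⟨αJ, hαJ, hJall⟩ := gradPhiBound_allOrders c₀ hc₀ Cη β hβ hβ' b hb hb'
  refine ⟨min (min αJ (β * b * (b - 1))) ((b - 1) * (1 - β) / 3),
    lt_min (lt_min hαJ hβb) (by positivity), fun α hα hαlt => ?_⟩
  have hα₁ : α < αJ := lt_of_lt_of_le hαlt ((min_le_left _ _).trans (min_le_left _ _))
  have hα₂ : α < β * b * (b - 1) := lt_of_lt_of_le hαlt ((min_le_left _ _).trans (min_le_right _ _))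
  have hα₃ : α < (b - 1) * (1 - β) / 3 := lt_of_lt_of_le hαlt (min_le_right _ _)
  have hαb : α < 2 * β * b * (b - 1) := by nlinarith
  -- the number of integrations by parts
  set K : ℕ := ⌈2 * (b - 1 + β) / ((b - 1) * (1 - β))⌉₊ + 1 with hKdef
  have hKineq : b - 1 + β < K * ((b - 1) * (1 - β) - 3 * α / 2) := by
    have hD : (b - 1) * (1 - β) / 2 ≤ (b - 1) * (1 - β) - 3 * α / 2 := by nlinarith
    have hKge : 2 * (b - 1 + β) / ((b - 1) * (1 - β)) < K := by
      rw [hKdef]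
      push_cast
      have := Nat.le_ceil (2 * (b - 1 + β) / ((b - 1) * (1 - β)))
      linarith
    have h1 : 2 * (b - 1 + β) < K * ((b - 1) * (1 - β)) := (div_lt_iff₀ hpos).1 hKge
    have hK0 : (0 : ℝ) ≤ K := Nat.cast_nonneg _
    nlinarith [mul_le_mul_of_nonneg_left hD hK0]
  obtain ⟨NJ, hNJ⟩ := hJall α hα hα₁ K
  obtain ⟨U, hU0, hU⟩ := 𝔚.exists_bound_descSet_fluctZ K
  refine ⟨max NJ K, fun Cin C₀ => ?_⟩
  -- constants
  set Cin' : ℝ := max Cin 0 with hCin'def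
  have hCp0 : 0 ≤ Cin' := le_max_right _ _
  obtain ⟨CJ, aJ, haJ, hCJall⟩ := hNJ Cin' C₀
  set CJ' : ℝ := max CJ 0 with hCJ'def
  have hCJ'0 : 0 ≤ CJ' := le_max_right _ _
  set Λ : ℝ := frameConst K CJ' Cin' with hΛdef
  have hΛ1 : 1 ≤ Λ := (frameConst_bounds K hCJ'0 hCp0).1
  have hΛ0 : 0 ≤ Λ := zero_le_one.trans hΛ1
  set Cη' : ℝ := ∑ k ∈ Finset.range (K + 1), |Cη 0 k| with hCη'def
  set c₁ : ℝ := (3 : ℝ) ^ K * (K + 1) with hc₁def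
  set F₁ : ℝ := c₁ * (c₁ * (1 / c₀ * (c₁ * Cη' ^ 2)) * Λ) * Λ with hF₁def
  have hF₁ : 0 ≤ F₁ := by positivity
  set PK : ℝ := (phaseConst K * Λ ^ 2) ^ K with hPKdef
  have hPK : 0 ≤ PK := pow_nonneg (mul_nonneg (phaseConst_nonneg K) (sq_nonneg Λ)) K
  -- thresholds
  obtain ⟨a₁, ha₁, hpar₁⟩ := exists_threshold_four_amp hb hαb
  obtain ⟨a₂, ha₂, hpar₂⟩ := exists_threshold_deformation hβ.le hb.le hα hCp0 (b := b)
  obtain ⟨a₃, ha₃, hpar₃⟩ := exists_threshold_freq_mul_mollScale_rpow_le hβ.le hb.le hα (8 * Cin')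
    (by norm_num : (0 : ℝ) < 1 / 100)
  obtain ⟨a₄, ha₄, hpar₄⟩ := exists_threshold_phase hb.le hKineq (β := β) (α := α)
  refine ⟨54 * PK * (2 * Real.pi) ^ K * F₁ * U, max (max (max a₁ a₂) (max a₃ a₄)) aJ,
    lt_max_of_lt_left (lt_max_of_lt_left (lt_max_of_lt_left ha₁)), fun a ha S H 𝒟 t ht => ?_⟩
  have ha₁' : a₁ ≤ a := le_trans (le_max_left _ _) (le_trans (le_max_left _ _) (le_trans (le_max_left _ _) ha))
  have ha₂' : a₂ ≤ a := le_trans (le_max_right _ _) (le_trans (le_max_left _ _) (le_trans (le_max_left _ _) ha))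
  have ha₃' : a₃ ≤ a := le_trans (le_max_left _ _) (le_trans (le_max_right _ _) (le_trans (le_max_left _ _) ha))
  have ha₄' : a₄ ≤ a := le_trans (le_max_right _ _) (le_trans (le_max_right _ _) (le_trans (le_max_left _ _) ha))
  have haJ' : aJ ≤ a := le_trans (le_max_right _ _) ha
  have ha1 : (1 : ℝ) ≤ a := ha₁.le.trans ha₁'
  have ha0 : (0 : ℝ) ≤ a := zero_le_one.trans ha1
  -- the hypotheses with the nonnegative constant `Cin'`
  have H' : PerturbationHypotheses ⟨β, α, a, b⟩ S (max NJ K) Cin' C₀ := H.mono_const ha1 (le_max_left _ _)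
  have HJ : PerturbationHypotheses ⟨β, α, a, b⟩ S NJ Cin' C₀ := H'.of_le (le_max_left _ _)
  have h4 := hpar₁ a ha₁' S.q
  have hdef := hpar₂ a ha₂' S.q
  have hstr : 8 * (Cin' * (freq a b S.q ^ α * mollScale β α a b S.q ^ α)) ≤ 1 / 100 := by
    have := hpar₃ a ha₃' S.q
    linarith
  -- scales
  set ℓ : ℝ := mollScale β α a b S.q with hℓdef
  set n : ℕ := Params.freqNat ⟨β, α, a, b⟩ (S.q + 1) with hndef
  set δ : ℝ := amp β a b (S.q + 1) with hδdef
  have hℓ : 0 < ℓ := mollScale_pos ha1 _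
  have hδ : 0 < δ := amp_pos ha1 _
  have hf1 := freq_pos (b := b) ha1 (S.q + 1)
  have hnr : (0 : ℝ) < n := Nat.cast_pos.2 (Params.freqNat_pos ⟨β, α, a, b⟩ ha1 _)
  set X : ℝ := phaseConst K * Λ ^ 2 * ((n : ℝ) * ℓ)⁻¹ with hXdef
  have hX : 0 ≤ X := mul_nonneg (mul_nonneg (phaseConst_nonneg K) (sq_nonneg Λ))
    (inv_nonneg.2 (mul_nonneg hnr.le hℓ.le))
  set B : ℝ := 27 * (X ^ K * (c₁ * (c₁ * (δ / c₀ * (c₁ * Cη' ^ 2)) * Λ) * Λ) * U) with hBdef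
  have hB0 : 0 ≤ B := by positivity
  have hρpos : ∀ s ∈ Icc 0 S.T, 0 < rhoQ ⟨β, α, a, b⟩ S s := fun s hs =>
    lt_of_lt_of_le (div_pos (mul_pos (amp_pos ha1 _) (Real.rpow_pos_of_pos (freq_pos ha1 _) _))
      (by norm_num)) (H'.le_rhoQ h4 hs)
  -- every summand is bounded by `B`
  have hterm : ∀ i, |oscTermI ⟨β, α, a, b⟩ S 𝔚 𝒟.cut.η 𝒟.D i t| ≤ B := by
    intro i
    by_cases hact : ∃ x, 𝒟.cut.η i t x ≠ 0
    · obtain ⟨x', hx'⟩ := hact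
      have hti : t ∈ tildeInterval S.T (Params.τ ⟨β, α, a, b⟩ S.q) i := 𝒟.cut.mem_tildeInterval ht hx'
      have hJK := fun k hk => hCJall a haJ' S HJ 𝒟 i k hk
      have hℓk : ∀ k : ℕ, 0 ≤ ℓ ^ (-(k : ℝ)) := fun k => Real.rpow_nonneg hℓ.le _
      have hJ : ∀ k ≤ K, Torus.eContDiffHolderNorm k 0 (fun x => gradPhi 𝒟.D i t x) ≤
          ENNReal.ofReal (CJ' * ℓ ^ (-(k : ℝ))) := fun k hk =>
        ((hJK k hk).1.mono (mul_le_mul_of_nonneg_right (le_max_left _ _) (hℓk k))) t hti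
      have hJinv : ∀ k ≤ K, Torus.eContDiffHolderNorm k 0 (fun x => (gradPhi 𝒟.D i t x)⁻¹) ≤
          ENNReal.ofReal (CJ' * ℓ ^ (-(k : ℝ))) := fun k hk =>
        ((hJK k hk).2.mono (mul_le_mul_of_nonneg_right (le_max_left _ _) (hℓk k))) t hti
      exact 𝒟.abs_oscTermI_le H' 𝔚 hc₀ hCp0 ha1 hb.le hβ.le hα.le h4 hdef hstr (le_max_right _ _)
        hCJ'0 ht hJ hJinv hx' hU0 hU
    · simp only [not_exists, not_not] at hact
      rw [oscTermI_eq_zero_of_eta 𝔚 𝒟 hact, abs_zero]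
      exact hB0
  -- at most two summands are nonzero
  have hτ : 0 < Params.τ ⟨β, α, a, b⟩ S.q := glueScale_pos ha1 _
  have hsum : |oscTerm ⟨β, α, a, b⟩ S 𝔚 𝒟.cut.η 𝒟.D t| ≤ 2 * B := by
    rw [𝒟.oscTerm_eq_sum H' 𝔚 hc₀ hρpos ht]
    exact (Finset.abs_sum_le_sum_abs _ _).trans (𝒟.cut.sum_abs_le_two_mul hτ hB0
      (fun i h0 => oscTermI_eq_zero_of_eta 𝔚 𝒟 h0) hterm _)
  refine hsum.trans ?_
  -- the parameter step: `X^K ≤ (phaseConst Λ²)^K (2π)^K δ_q^{1/2} λ_q λ_{q+1}⁻¹`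
  set T₀ : ℝ := Real.sqrt (amp β a b S.q) * freq a b S.q * (freq a b (S.q + 1))⁻¹ with hT₀def
  have hT₀ : 0 ≤ T₀ :=
    mul_nonneg (mul_nonneg (Real.sqrt_nonneg _) (freq_pos ha1 _).le) (inv_nonneg.2 hf1.le)
  have hfreq : freq a b (S.q + 1) = 2 * Real.pi * (n : ℝ) := Params.freq_eq ⟨β, α, a, b⟩ ha0 (S.q + 1)
  have hnl : ((n : ℝ) * ℓ)⁻¹ = 2 * Real.pi * (ℓ * freq a b (S.q + 1))⁻¹ := by
    rw [hfreq]
    field_simp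
  have hnlK : (((n : ℝ) * ℓ)⁻¹) ^ K ≤ (2 * Real.pi) ^ K * T₀ := by
    rw [hnl, mul_pow]
    exact mul_le_mul_of_nonneg_left (hpar₄ a ha₄' S.q) (by positivity)
  have hXK : X ^ K ≤ PK * ((2 * Real.pi) ^ K * T₀) := by
    rw [hXdef, mul_pow, ← hPKdef]
    exact mul_le_mul_of_nonneg_left hnlK hPK
  have hF : c₁ * (c₁ * (δ / c₀ * (c₁ * Cη' ^ 2)) * Λ) * Λ = F₁ * δ := by
    rw [hF₁def]
    ring
  calc 2 * B = 54 * X ^ K * (F₁ * δ) * U := by rw [hBdef, hF]; ring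
    _ ≤ 54 * (PK * ((2 * Real.pi) ^ K * T₀)) * (F₁ * δ) * U := by
        gcongr
    _ = 54 * PK * (2 * Real.pi) ^ K * F₁ * U * (δ * T₀) := by ring
    _ = 54 * PK * (2 * Real.pi) ^ K * F₁ * U *
        (amp β a b (S.q + 1) * Real.sqrt (amp β a b S.q) * freq a b S.q * (freq a b (S.q + 1))⁻¹) := by
        rw [hδdef, hT₀def]
        ring

/-- **Discharge of G₃ `BDSV.energy_principalTerm`** (`|∫|w_o|² - 3ρ_q| ≲ δ_{q+1}δ_q^{1/2}λ_qλ_{q+1}⁻¹`,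
BDSV, proof of Prop. 6.2, last paragraph): the proved reduction
`BDSV.energy_principalTerm_of_oscillatoryTerm` applied to `BDSV.energy_oscillatoryTerm_holds`.
[cite: BuckmasterEtAl2018, Prop. 6.2 (proof, last paragraph)] -/
theorem energy_principalTerm_holds : energy_principalTerm :=
  energy_principalTerm_of_oscillatoryTerm energy_oscillatoryTerm_holds

end Discharge

end BDSV

end Literature.Analysis.FluidPDE
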